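import Literature.Analysis.FluidPDE.TaoEnstrophyLocalisationProofs
import Literature.Analysis.FluidPDE.VorticityCalculus
import HarnessLib

/-!
# LINE g7-δ «member selection», T1 tool: BUDGET RETENTION near an efficient cell

Crux `NearExtremalTransiencePerFlow` (stmt-NavierStokesRegularity-26567), line δ `member_selection`, stub T1
`stub_coherentSelection`; critic idea-crit-4 (2026-08-28T20:03:54Z, N1): the T1 GUARD G1
(`…MemberSelection.Guard.efficientCellHasStrongVorticity`, landed) says that a `κ`-efficient cell at global height with
Taylor scale `≤ L₁` forces, on its `s`-neighbourhood `N`, `A + s·B ≥ m := κ·Mv/(2CL₁)` for EVERY pair of bounds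
`A ≥ ‖curl v‖`, `B ≥ ‖D curl v‖` on `N`; «budget retention» turns this into a LOWER bound for the restricted budget of a
unit ball near the cell, uniform in the zoom family (the `C³` bounds of `NearExtremalFamily` make `curl v` and `D curl v`
uniformly Lipschitz), so that the `C^∞_loc` limit of the translates centred there (landed
`exists_limit_of_nearExtremalFamily`) is NOT trivial on the unit ball.

* `exists_norm_ge_of_forall_bounds` — if `m ≤ A + s B` for all bounds `A, B` of `‖f‖, ‖g‖` on a non-empty set `N`
  (with `g` bounded on `N`), then some `y ∈ N` has `m/4 ≤ ‖f y‖` or some `y ∈ N` has `m/4 ≤ s ‖g y‖`;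
* `setIntegral_sq_norm_ge_of_lipschitz` — a Lipschitz `f` with `‖f y‖ ≥ μ > 0` has
  `∫_{B(y,1)} ‖f‖² ≥ (μ/2)² · |B(0, min 1 (μ/(2K)))|`;
* `budgetRetention` — for a `C³` field `v` with `‖curl v‖`, `‖D curl v‖` `K₁`-, `K₂`-Lipschitz and the G1-type
  hypothesis on a non-empty `N`, some `y ∈ N` has
  `∫_{B(y,1)} (‖curl v‖² + |D curl v|²_F) ≥ c` with an explicit `c = c(m, s, K₁, K₂) > 0`.

Pure real analysis; nothing here is a statement about Navier–Stokes. 26567, T1, T3, NS regularity OPEN. No summit is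
proved by a line.
-/

noncomputable section

open scoped Topology InnerProductSpace RealInnerProductSpace ENNReal ContDiff
open MeasureTheory Filter Set Metric
open Literature.Analysis.FluidPDE

namespace Summit.NavierStokesRegularity.NavierStokesRegularity.Theorems.NearExtremalTransiencePerFlow.MemberSelection

set_option linter.dupNamespace false

/-! ### From «every pair of bounds is large» to a point with a large value -/

section Sup

variable {X F G : Type*} [NormedAddCommGroup F] [NormedAddCommGroup G]

/-- If `m ≤ A + s·B` for ALL upper bounds `A` of `‖f‖` and `B` of `‖g‖` on a non-empty set `N` on which `g` is
bounded, then (`s ≥ 0`) some point of `N` has `m/4 ≤ ‖f y‖`, or some point has `m/4 ≤ s·‖g y‖`. [folklore] -/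
theorem exists_norm_ge_of_forall_bounds {f : X → F} {g : X → G} {N : Set X} (hN : N.Nonempty) {m s B₀ : ℝ}
    (hs : 0 ≤ s) (hB₀ : ∀ y ∈ N, ‖g y‖ ≤ B₀)
    (h : ∀ A B : ℝ, (∀ y ∈ N, ‖f y‖ ≤ A) → (∀ y ∈ N, ‖g y‖ ≤ B) → m ≤ A + s * B) :
    (∃ y ∈ N, m / 4 ≤ ‖f y‖) ∨ (∃ y ∈ N, m / 4 ≤ s * ‖g y‖) := by
  by_contra hcon
  push Not at hcon
  obtain ⟨hf, hg⟩ := hcon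
  -- then `m/4` bounds `‖f‖` and `s‖g‖` on `N`
  have hA : ∀ y ∈ N, ‖f y‖ ≤ m / 4 := fun y hy => (hf y hy).le
  rcases eq_or_lt_of_le hs with hs0 | hs0
  · -- `s = 0`: `m ≤ m/4 + 0·B₀`
    have h1 := h (m / 4) B₀ hA hB₀
    rw [← hs0, zero_mul, add_zero] at h1
    obtain ⟨y, hy⟩ := hN
    have h2 := hf y hy
    have h3 : 0 ≤ ‖f y‖ := norm_nonneg _
    linarith
  · have hB : ∀ y ∈ N, ‖g y‖ ≤ m / (4 * s) := by
      intro y hy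
      rw [le_div_iff₀ (by positivity)]
      have := hg y hy
      nlinarith
    have h1 := h (m / 4) (m / (4 * s)) hA hB
    have h2 : s * (m / (4 * s)) = m / 4 := by field_simp
    rw [h2] at h1
    obtain ⟨y, hy⟩ := hN
    have h3 := hf y hy
    have h4 : 0 ≤ ‖f y‖ := norm_nonneg _
    linarith

end Sup

/-! ### A Lipschitz function with a large value has `L²` mass on the unit ball -/

section Mass

variable {F : Type*} [NormedAddCommGroup F]

/-- On the ball `B(y, μ/(2K))` a `K`-Lipschitz `f` with `‖f y‖ ≥ μ` stays `≥ μ/2`. [folklore] -/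
theorem norm_ge_half_of_lipschitz {f : EuclideanSpace ℝ (Fin 3) → F} {y : EuclideanSpace ℝ (Fin 3)} {μ K : ℝ}
    (hK : 0 < K) (hlip : ∀ z, ‖f z - f y‖ ≤ K * ‖z - y‖) (hμ : μ ≤ ‖f y‖) {z : EuclideanSpace ℝ (Fin 3)}
    (hz : z ∈ ball y (μ / (2 * K))) : μ / 2 ≤ ‖f z‖ := by
  rw [mem_ball, dist_eq_norm] at hz
  have h1 : ‖f z - f y‖ < μ / 2 := by
    calc ‖f z - f y‖ ≤ K * ‖z - y‖ := hlip z
      _ < K * (μ / (2 * K)) := mul_lt_mul_of_pos_left hz hK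
      _ = μ / 2 := by field_simp
  have h2 : ‖f y‖ ≤ ‖f z‖ + ‖f z - f y‖ := by
    calc ‖f y‖ = ‖f z - (f z - f y)‖ := by rw [sub_sub_cancel]
      _ ≤ ‖f z‖ + ‖f z - f y‖ := norm_sub_le _ _
  linarith

/-- **`L²` mass from a large value and a Lipschitz bound**: if `f` is continuous, `K`-Lipschitz (`K > 0`), and
`‖f y‖ ≥ μ > 0`, then `∫_{B(y,1)} ‖f‖² ≥ (μ/2)² · |B(0, min 1 (μ/(2K)))|`. [folklore] -/
theorem setIntegral_sq_norm_ge_of_lipschitz {f : EuclideanSpace ℝ (Fin 3) → F} (hf : Continuous f)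
    {y : EuclideanSpace ℝ (Fin 3)} {μ K : ℝ} (hμ0 : 0 < μ) (hK : 0 < K)
    (hlip : ∀ z, ‖f z - f y‖ ≤ K * ‖z - y‖) (hμ : μ ≤ ‖f y‖) :
    (μ / 2) ^ 2 * (volume : Measure (EuclideanSpace ℝ (Fin 3))).real (ball 0 (min 1 (μ / (2 * K)))) ≤
      ∫ x in ball y 1, ‖f x‖ ^ 2 := by
  set r : ℝ := min 1 (μ / (2 * K)) with hr
  have hr0 : 0 < r := lt_min one_pos (by positivity)
  have hsub : ball y r ⊆ ball y 1 := ball_subset_ball (min_le_left _ _)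
  have hsub' : ball y r ⊆ ball y (μ / (2 * K)) := ball_subset_ball (min_le_right _ _)
  have hint1 : IntegrableOn (fun x => ‖f x‖ ^ 2) (ball y 1) volume :=
    ((hf.norm.pow 2).continuousOn.integrableOn_compact (isCompact_closedBall y 1)).mono_set
      ball_subset_closedBall
  -- lower bound on the small ball, then monotonicity in the set
  have hvol : (volume : Measure (EuclideanSpace ℝ (Fin 3))).real (ball y r) =
      (volume : Measure (EuclideanSpace ℝ (Fin 3))).real (ball 0 r) := by
    simp only [Measure.real, Measure.addHaar_ball_center]
  calc (μ / 2) ^ 2 * (volume : Measure (EuclideanSpace ℝ (Fin 3))).real (ball 0 r)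
      = ∫ _ in ball y r, (μ / 2) ^ 2 := by rw [setIntegral_const, smul_eq_mul, mul_comm, hvol]
    _ ≤ ∫ x in ball y r, ‖f x‖ ^ 2 := by
        refine setIntegral_mono_on ?_ (hint1.mono_set hsub) measurableSet_ball fun x hx => ?_
        · exact (integrableOn_const_iff).2 (Or.inr (measure_ball_lt_top))
        · exact pow_le_pow_left₀ (by positivity) (norm_ge_half_of_lipschitz hK hlip hμ (hsub' hx)) 2
    _ ≤ ∫ x in ball y 1, ‖f x‖ ^ 2 :=
        setIntegral_mono_set hint1 (Eventually.of_forall fun x => sq_nonneg _) (Eventually.of_forall hsub)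

end Mass

/-! ### Budget retention -/

section Retention

/-- **Budget retention near an efficient cell.** Let `v : ℝ³ → ℝ³` be `C³` with `curl v` `K₁`-Lipschitz and `D(curl v)`
`K₂`-Lipschitz (`K₁, K₂ > 0`), `D curl v` bounded on a non-empty set `N`, and suppose the G1-type conclusion
holds on `N`: `m ≤ A + s·B` for all bounds `A ≥ ‖curl v‖`, `B ≥ ‖D curl v‖` on `N` (`m, s > 0`). Then some `y ∈ N` carries
restricted budget on the unit ball:
`min ((m/8)²·|B(0, min 1 (m/(8K₁)))|) ((m/(8s))²·|B(0, min 1 (m/(8sK₂)))|) ≤ ∫_{B(y,1)} (‖curl v‖² + |D curl v|²_F)`.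
[folklore] -/
theorem budgetRetention {v : EuclideanSpace ℝ (Fin 3) → EuclideanSpace ℝ (Fin 3)} (hv : ContDiff ℝ 3 v)
    {N : Set (EuclideanSpace ℝ (Fin 3))} (hN : N.Nonempty) {m s K₁ K₂ B₀ : ℝ} (hm : 0 < m) (hs : 0 < s)
    (hK₁ : 0 < K₁) (hK₂ : 0 < K₂)
    (hlip₁ : ∀ z y, ‖curl v z - curl v y‖ ≤ K₁ * ‖z - y‖)
    (hlip₂ : ∀ z y, ‖fderiv ℝ (curl v) z - fderiv ℝ (curl v) y‖ ≤ K₂ * ‖z - y‖)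
    (hB₀ : ∀ y ∈ N, ‖fderiv ℝ (curl v) y‖ ≤ B₀)
    (hG : ∀ A B : ℝ, (∀ y ∈ N, ‖curl v y‖ ≤ A) → (∀ y ∈ N, ‖fderiv ℝ (curl v) y‖ ≤ B) → m ≤ A + s * B) :
    ∃ y ∈ N, min ((m / 8) ^ 2 * (volume : Measure (EuclideanSpace ℝ (Fin 3))).real (ball 0 (min 1 (m / 4 / (2 * K₁)))))
        ((m / (4 * s) / 2) ^ 2 * (volume : Measure (EuclideanSpace ℝ (Fin 3))).real
          (ball 0 (min 1 (m / (4 * s) / (2 * K₂))))) ≤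
      ∫ x in ball y 1, (‖curl v x‖ ^ 2 + frobeniusNormSq (fderiv ℝ (curl v) x)) := by
  have hcurl : Continuous (curl v) := (contDiff_curl (n := 2) (by exact_mod_cast hv)).continuous
  have hDcurl : Continuous (fderiv ℝ (curl v)) :=
    (contDiff_curl (n := 2) (by exact_mod_cast hv)).continuous_fderiv (by norm_num)
  -- integrability of the two densities on unit balls
  have hZi : ∀ y, IntegrableOn (fun x => ‖curl v x‖ ^ 2) (ball y 1) volume := fun y =>
    ((hcurl.norm.pow 2).continuousOn.integrableOn_compact (isCompact_closedBall y 1)).mono_set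
      ball_subset_closedBall
  have hPi : ∀ y, IntegrableOn (fun x => frobeniusNormSq (fderiv ℝ (curl v) x)) (ball y 1) volume := fun y => by
    have hc : Continuous fun x => frobeniusNormSq (fderiv ℝ (curl v) x) := by
      unfold frobeniusNormSq
      refine continuous_finsetSum _ fun i _ => ?_
      exact ((hDcurl.clm_apply continuous_const).norm).pow 2
    exact (hc.continuousOn.integrableOn_compact (isCompact_closedBall y 1)).mono_set ball_subset_closedBall
  have hP0 : ∀ x, 0 ≤ frobeniusNormSq (fderiv ℝ (curl v) x) := fun x => by
    unfold frobeniusNormSq; exact Finset.sum_nonneg fun i _ => sq_nonneg _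
  have hsplit : ∀ y, ∫ x in ball y 1, (‖curl v x‖ ^ 2 + frobeniusNormSq (fderiv ℝ (curl v) x)) =
      (∫ x in ball y 1, ‖curl v x‖ ^ 2) + ∫ x in ball y 1, frobeniusNormSq (fderiv ℝ (curl v) x) := fun y =>
    integral_add (hZi y) (hPi y)
  have hZ0 : ∀ y, 0 ≤ ∫ x in ball y 1, ‖curl v x‖ ^ 2 := fun y => integral_nonneg fun x => sq_nonneg _
  have hP0' : ∀ y, 0 ≤ ∫ x in ball y 1, frobeniusNormSq (fderiv ℝ (curl v) x) := fun y => integral_nonneg hP0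
  rcases exists_norm_ge_of_forall_bounds hN hs.le hB₀ hG with ⟨y, hy, hfy⟩ | ⟨y, hy, hgy⟩
  · -- strong VORTICITY at `y`
    refine ⟨y, hy, ?_⟩
    have hmass := setIntegral_sq_norm_ge_of_lipschitz hcurl (y := y) (by positivity : 0 < m / 4) hK₁
      (fun z => hlip₁ z y) hfy
    rw [hsplit y]
    calc min ((m / 8) ^ 2 * (volume : Measure (EuclideanSpace ℝ (Fin 3))).real (ball 0 (min 1 (m / 4 / (2 * K₁)))))
          ((m / (4 * s) / 2) ^ 2 * (volume : Measure (EuclideanSpace ℝ (Fin 3))).real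
            (ball 0 (min 1 (m / (4 * s) / (2 * K₂)))))
        ≤ (m / 8) ^ 2 * (volume : Measure (EuclideanSpace ℝ (Fin 3))).real (ball 0 (min 1 (m / 4 / (2 * K₁)))) :=
          min_le_left _ _
      _ = (m / 4 / 2) ^ 2 * (volume : Measure (EuclideanSpace ℝ (Fin 3))).real (ball 0 (min 1 (m / 4 / (2 * K₁)))) := by
          ring_nf
      _ ≤ ∫ x in ball y 1, ‖curl v x‖ ^ 2 := hmass
      _ ≤ (∫ x in ball y 1, ‖curl v x‖ ^ 2) + ∫ x in ball y 1, frobeniusNormSq (fderiv ℝ (curl v) x) :=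
          le_add_of_nonneg_right (hP0' y)
  · -- strong VORTICITY GRADIENT at `y`
    refine ⟨y, hy, ?_⟩
    have hgy' : m / (4 * s) ≤ ‖fderiv ℝ (curl v) y‖ := by
      rw [div_le_iff₀ (by positivity)]
      calc m = m / 4 * 4 := by ring
        _ ≤ s * ‖fderiv ℝ (curl v) y‖ * 4 := by gcongr
        _ = ‖fderiv ℝ (curl v) y‖ * (4 * s) := by ring
    have hmass := setIntegral_sq_norm_ge_of_lipschitz hDcurl (y := y) (by positivity : 0 < m / (4 * s)) hK₂
      (fun z => hlip₂ z y) hgy'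
    -- `‖L‖² ≤ |L|²_F`
    have hcomp : ∫ x in ball y 1, ‖fderiv ℝ (curl v) x‖ ^ 2 ≤ ∫ x in ball y 1, frobeniusNormSq (fderiv ℝ (curl v) x) := by
      refine setIntegral_mono_on ?_ (hPi y) measurableSet_ball fun x _ => sq_opNorm_le_frobeniusNormSq _
      exact ((hDcurl.norm.pow 2).continuousOn.integrableOn_compact (isCompact_closedBall y 1)).mono_set
        ball_subset_closedBall
    rw [hsplit y]
    calc min ((m / 8) ^ 2 * (volume : Measure (EuclideanSpace ℝ (Fin 3))).real (ball 0 (min 1 (m / 4 / (2 * K₁)))))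
          ((m / (4 * s) / 2) ^ 2 * (volume : Measure (EuclideanSpace ℝ (Fin 3))).real
            (ball 0 (min 1 (m / (4 * s) / (2 * K₂)))))
        ≤ (m / (4 * s) / 2) ^ 2 * (volume : Measure (EuclideanSpace ℝ (Fin 3))).real
            (ball 0 (min 1 (m / (4 * s) / (2 * K₂)))) := min_le_right _ _
      _ ≤ ∫ x in ball y 1, ‖fderiv ℝ (curl v) x‖ ^ 2 := hmass
      _ ≤ ∫ x in ball y 1, frobeniusNormSq (fderiv ℝ (curl v) x) := hcomp
      _ ≤ (∫ x in ball y 1, ‖curl v x‖ ^ 2) + ∫ x in ball y 1, frobeniusNormSq (fderiv ℝ (curl v) x) :=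
          le_add_of_nonneg_left (hZ0 y)

end Retention

end Summit.NavierStokesRegularity.NavierStokesRegularity.Theorems.NearExtremalTransiencePerFlow.MemberSelection
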